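import Summits.QuantumFields.YangMills.Theorems.LuscherReductionTwistedTraceScalingValleySchurDoor
import HarnessLib

/-!
# The REFINED onion: the action cut-off costs only `e^{−βη/2}` (Boltzmann suppression in its own transition zone), so the VALLEY may sit at any
# action scale `η = β^{−q}`, `q < 1` — in particular `q > 1/2`, where every valley point has `S ≪ β^{−1/2}` and the harmonic/Born–Oppenheimer step
# analysis is uniformly precise (lane A of S-BASE, crux `TwistedTraceScaling` stmt-QuantumFields-20203 / KT-door 3b′; design note
# `pub/ym-fleet/ym-luscher-20007-p1/COARSE-DESIGN.md` §15)

The onion theorem `qform_le_three_regions_lat` (`…ActionPhase`) localises the VALLEY piece in the action with the phase `Θ'_η = actionPhase η`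
(`= 0` on `{S ≤ η}`, `= π/2` on `{S ≥ 2η}`) and pays the generic link-Lipschitz IMS defect `½|E|²(3/β)(4π|P|/η)²·c_β^{|E|}‖ψ‖²`, which forces
`η ≫ β^{−1/3}` (`ScalesAdmissible`, `scalesAdmissible_powScale₂`: `q < 1/3`).  But the transfer kernel is in KAC form,
`K_β(U,V) = E_β(U,V)·e^{−(β/2)(S(U)+S(V))}` (`transferKernel_eq_latE_mul`), and the IMS defect `Σ_a (J_a(U) − J_a(V))²` of the action partition VANISHES
unless one of `S(U)`, `S(V)` exceeds `η` — where the kernel itself carries `e^{−βη/2}`.  Hence (§1) the defect row is at most `(π²/4)·e^{−βη/2}·c_β^{|E|}`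
with NO `1/η²`, and (§2) the refined onion

  ★★ `qform_le_three_regions_lat₂`: `⟨ψ,Kψ⟩ ≤ ⟨ψ_in,Kψ_in⟩ + ⟨ψ_val,Kψ_val⟩ + onionErr₂ L β δ η · c_β^{|E|} · ‖ψ‖²`,
  `onionErr₂ L β δ η = e^{−βη} + (π²/8)e^{−βη/2} + ½|E|²(3/β)(8π/δ)²` (same pieces `ψ_in = cos Θ_δ·ψ`, `ψ_val = cos Θ'_η·(sin Θ_δ·ψ)`).

§3: `ScalesAdmissible₂` (the same admissibility with `onionErr₂`), `onionErr₂_le_onionErr`-free direct proofs ★ `scalesAdmissible₂_powScale : 0 < p < 1/3 →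
0 < q < 1 → ScalesAdmissible₂ L (β^{−p}) (β^{−q})`.  The glue re-run (`boUpper_of_valley_inner₂`, `coarseNoIntruderAt_of_valley_inner₂ / _valley_oneOrbit_pow₃ / _kernelRow_pow₃`: COARSE-UPPER(L) ⇐
`ValleyKernelRowBoundAt L (β^{−p}) (β^{−q})` + `InnerNoIntruderOneOrbitAt L (β^{−p})` for `0 < p < 1/3`, `q < 2/3`) is the companion file `…OnionRefinedGlue`.
WHY IT MATTERS (design §15): at `q > 1/2` the valley has `βS(U)² → 0` and `βS(U)ρ → 0` uniformly, so lane B's chart sandwich and the Born–Oppenheimer weight are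
uniformly precise on the whole valley; at `q > 4p` the constant non-commuting corner (disprover R8/R9) is excluded from the valley by action alone.
HONEST FRAMING: localisation bookkeeping for a stub lane of a child of the CONDITIONAL reduction route; C3/C4 remain OPEN; femto rung R2b1; not a gap, not Clay.
-/

set_option autoImplicit false

noncomputable section

open MeasureTheory Filter Topology Real
open scoped Matrix ComplexConjugate BigOperators
open Literature.MathematicalPhysics.QuantumFieldTheory
open Literature.MathematicalPhysics.QuantumLattice

namespace Summit.QuantumFields.YangMills.Theorems.FemtoTransferGap

variable {L : ℕ} [NeZero L]

/-! ## §1 The defect row of the action partition is Boltzmann-suppressed -/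

/-- The action phase takes values in `[0, π/2]`. [folklore] -/
theorem actionPhase_mem (η : ℝ) (U : GaugeConfig 3 L SU2) : 0 ≤ actionPhase η U ∧ actionPhase η U ≤ π / 2 := by
  unfold actionPhase
  have h0 := bump_nonneg (wilsonAction su2Rep U / (2 * η))
  have h1 := bump_le_one (wilsonAction su2Rep U / (2 * η))
  constructor
  · exact mul_nonneg (by positivity) (by linarith)
  · nlinarith [Real.pi_pos]

/-- Below the threshold the action phase vanishes: `S(U) ≤ η ⇒ Θ'_η(U) = 0` (`η > 0`). [folklore] -/
theorem actionPhase_eq_zero_of_le {η : ℝ} (hη : 0 < η) {U : GaugeConfig 3 L SU2} (hS : wilsonAction su2Rep U ≤ η) : actionPhase η U = 0 := by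
  unfold actionPhase
  rw [bump_eq_one (by rw [div_le_iff₀ (by positivity)]; linarith), sub_self, mul_zero]

/-- ★ **Pointwise**: `K_β(U,V)·[(cos Θ'_U − cos Θ'_V)² + (sin Θ'_U − sin Θ'_V)²] ≤ (π²/4)·e^{−βη/2}·E_β(U,V)` for `Θ' = actionPhase η` (`β ≥ 0`, `η > 0`):
the defect vanishes unless `max(S(U),S(V)) > η`, where the Kac factor `e^{−(β/2)(S(U)+S(V))}` is below `e^{−βη/2}`. [cite: SimonB1983DiscreteSpectrum, §3] -/
theorem kernel_mul_actionDefect_le {β : ℝ} (hβ : 0 ≤ β) {η : ℝ} (hη : 0 < η) (U V : GaugeConfig 3 L SU2) :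
    transferKernel su2Rep β U V *
        ((Real.cos (actionPhase η U) - Real.cos (actionPhase η V)) ^ 2 + (Real.sin (actionPhase η U) - Real.sin (actionPhase η V)) ^ 2) ≤
      (π ^ 2 / 4) * Real.exp (-(β * η / 2)) * latE L β U V := by
  set D : ℝ := (Real.cos (actionPhase η U) - Real.cos (actionPhase η V)) ^ 2 +
    (Real.sin (actionPhase η U) - Real.sin (actionPhase η V)) ^ 2 with hDdef
  have hD0 : 0 ≤ D := by rw [hDdef]; positivity
  have hchord : ∀ a b : ℝ, (Real.cos a - Real.cos b) ^ 2 + (Real.sin a - Real.sin b) ^ 2 ≤ (a - b) ^ 2 := fun a b => by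
    have h1 : (Real.cos a - Real.cos b) ^ 2 + (Real.sin a - Real.sin b) ^ 2 = 2 - 2 * Real.cos (a - b) := by
      rw [Real.cos_sub]
      nlinarith [Real.cos_sq_add_sin_sq a, Real.cos_sq_add_sin_sq b]
    rw [h1]
    have h2 := Real.one_sub_sq_div_two_le_cos (x := a - b)
    linarith
  have hD : D ≤ π ^ 2 / 4 := by
    refine (hchord _ _).trans ?_
    obtain ⟨hU0, hU1⟩ := actionPhase_mem η U
    obtain ⟨hV0, hV1⟩ := actionPhase_mem η V
    have hab : |actionPhase η U - actionPhase η V| ≤ π / 2 := by rw [abs_le]; constructor <;> linarith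
    have := pow_le_pow_left₀ (abs_nonneg _) hab 2
    rw [sq_abs] at this
    linarith [this]
  have hE := (latE_pos (L := L) β U V).le
  by_cases hUV : wilsonAction su2Rep U ≤ η ∧ wilsonAction su2Rep V ≤ η
  · -- no defect
    have hz : D = 0 := by
      rw [hDdef, actionPhase_eq_zero_of_le hη hUV.1, actionPhase_eq_zero_of_le hη hUV.2]; ring
    rw [hz, mul_zero]; positivity
  · -- Boltzmann suppression
    have hsum : η < wilsonAction su2Rep U + wilsonAction su2Rep V := by
      rw [not_and_or, not_le, not_le] at hUV
      rcases hUV with h | h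
      · linarith [wilsonAction_su2_nonneg_lat V]
      · linarith [wilsonAction_su2_nonneg_lat U]
    have hK : transferKernel su2Rep β U V ≤ Real.exp (-(β * η / 2)) * latE L β U V := by
      rw [transferKernel_eq_latE_mul, mul_comm]
      refine mul_le_mul_of_nonneg_right (Real.exp_le_exp.mpr ?_) hE
      nlinarith
    calc transferKernel su2Rep β U V * D ≤ (Real.exp (-(β * η / 2)) * latE L β U V) * (π ^ 2 / 4) :=
          mul_le_mul hK hD hD0 (by positivity)
      _ = (π ^ 2 / 4) * Real.exp (-(β * η / 2)) * latE L β U V := by ring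

/-- `V ↦ E_β(U,V)` is integrable (bounded continuous on a probability space). [folklore] -/
theorem integrable_latE_right {β : ℝ} (hβ : 0 ≤ β) (U : GaugeConfig 3 L SU2) : Integrable (fun V : GaugeConfig 3 L SU2 => latE L β U V) (configMeasure SU2 L) := by
  haveI := secondCountableTopology_su2
  have hm : Measurable (Function.uncurry fun (U' V : GaugeConfig 3 L SU2) => latE L β U' V) := measurable_latE β
  refine Integrable.mono' (integrable_const (Real.exp (2 * β) ^ Fintype.card (Edge 3 L))) hm.of_uncurry_left.aestronglyMeasurable
    (ae_of_all _ fun V => ?_)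
  rw [Real.norm_eq_abs]; exact abs_latE_le hβ U V

/-- ★ **Defect row of the action partition**: `∫ K_β(U,V)[(cos Θ'_U − cos Θ'_V)² + (sin Θ'_U − sin Θ'_V)²] dV ≤ (π²/4)·e^{−βη/2}·c_β^{|E|}` (`β ≥ 0`, `η > 0`) —
no `1/η²`. [cite: SimonB1983DiscreteSpectrum, §3] -/
theorem defectRow_actionPhase_le {β : ℝ} (hβ : 0 ≤ β) {η : ℝ} (hη : 0 < η) (U : GaugeConfig 3 L SU2) :
    ∫ V, transferKernel su2Rep β U V *
        ((Real.cos (actionPhase η U) - Real.cos (actionPhase η V)) ^ 2 + (Real.sin (actionPhase η U) - Real.sin (actionPhase η V)) ^ 2)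
        ∂configMeasure SU2 L ≤
      (π ^ 2 / 4) * Real.exp (-(β * η / 2)) * latCE L β := by
  have hint := (integrable_latE_right hβ U).const_mul ((π ^ 2 / 4) * Real.exp (-(β * η / 2)))
  calc ∫ V, transferKernel su2Rep β U V *
        ((Real.cos (actionPhase η U) - Real.cos (actionPhase η V)) ^ 2 + (Real.sin (actionPhase η U) - Real.sin (actionPhase η V)) ^ 2)
        ∂configMeasure SU2 L
      ≤ ∫ V, (π ^ 2 / 4) * Real.exp (-(β * η / 2)) * latE L β U V ∂configMeasure SU2 L := by
        refine integral_mono_of_nonneg (ae_of_all _ fun V => ?_) hint (ae_of_all _ fun V => kernel_mul_actionDefect_le hβ hη U V)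
        exact mul_nonneg (transferKernel_pos su2Rep β U V).le (by positivity)
    _ = (π ^ 2 / 4) * Real.exp (-(β * η / 2)) * latCE L β := by rw [integral_const_mul, integral_latE_snd]

/-- ★ **IMS in the action with the Boltzmann-suppressed defect**: for `β > 0`, `η > 0` and every physical `φ`,
`⟨φ,Kφ⟩ ≤ ⟨cos Θ'_η φ, K cos Θ'_η φ⟩ + ⟨sin Θ'_η φ, K sin Θ'_η φ⟩ + (π²/8)·e^{−βη/2}·c_β^{|E|}·‖φ‖²`. [cite: SimonB1983DiscreteSpectrum, §3] -/
theorem qform_le_localized_actionPhase₂ {β : ℝ} (hβ : 0 < β) {η : ℝ} (hη : 0 < η) {φ : GaugeConfig 3 L SU2 → ℝ} (hφ : IsPhys φ) :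
    qform su2Rep β φ φ ≤ qform su2Rep β (fun U => Real.cos (actionPhase η U) * φ U) (fun U => Real.cos (actionPhase η U) * φ U)
      + qform su2Rep β (fun U => Real.sin (actionPhase η U) * φ U) (fun U => Real.sin (actionPhase η U) * φ U)
      + (1 / 2) * ((π ^ 2 / 4) * Real.exp (-(β * η / 2)) * latCE L β) * l2 φ φ := by
  set J : Fin 2 → GaugeConfig 3 L SU2 → ℝ := fun a U => ![Real.cos (actionPhase η U), Real.sin (actionPhase η U)] a with hJ
  have hJm : ∀ a, Measurable (J a) := by
    intro a
    fin_cases a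
    · exact Real.continuous_cos.measurable.comp (measurable_actionPhase η)
    · exact Real.continuous_sin.measurable.comp (measurable_actionPhase η)
  have hJsum : ∀ U, ∑ a, J a U ^ 2 = 1 := fun U => sum_fin_two_cos_sin_sq_lat (actionPhase η) U
  have hJg : ∀ a (g : Site 3 L → SU2) (U : GaugeConfig 3 L SU2), J a (gaugeTransform g U) = J a U := by
    intro a g U; simp only [hJ, actionPhase_gaugeTransform η g U]
  have hJz : ∀ a (k : Fin 3), ∀ z ∈ Subgroup.center SU2, ∀ U : GaugeConfig 3 L SU2, J a (twist k z U) = J a U := by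
    intro a k z hz U; simp only [hJ, actionPhase_twist η k hz U]
  have hM : ∀ U : GaugeConfig 3 L SU2, ∫ V, transferKernel su2Rep β U V * ∑ a, (J a U - J a V) ^ 2 ∂configMeasure SU2 L
      ≤ (π ^ 2 / 4) * Real.exp (-(β * η / 2)) * latCE L β := fun U => by
    have h := defectRow_actionPhase_le hβ.le hη U
    simp only [hJ, Fin.sum_univ_two, Matrix.cons_val_zero, Matrix.cons_val_one]
    exact h
  have h := qform_su2Rep_le_sum_localized_add β J hJm hJsum hJg hJz hM hφ
  simp only [hJ, Fin.sum_univ_two, Matrix.cons_val_zero, Matrix.cons_val_one] at h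
  exact h

/-! ## §2 The refined onion -/

variable (L) in
/-- **Refined onion error** `onionErr₂ L β δ η = e^{−βη} + (π²/8)e^{−βη/2} + ½|E|²(3/β)(8π/δ)²`: the action cut-off costs only Boltzmann factors.
[cite: SimonB1983DiscreteSpectrum, §3] -/
def onionErr₂ (β δ η : ℝ) : ℝ :=
  Real.exp (-(β * η)) + π ^ 2 / 8 * Real.exp (-(β * η / 2)) + (1 / 2) * ((Fintype.card (Edge 3 L) : ℝ) ^ 2 * (3 / β) * (8 * π / δ) ^ 2)

/-- `0 < onionErr₂` for `β > 0`. [folklore] -/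
theorem onionErr₂_pos {β δ η : ℝ} (hβ : 0 < β) : 0 < onionErr₂ L β δ η := by
  unfold onionErr₂; positivity

/-- ★★ **The refined onion theorem: INNER + VALLEY + LARGE FIELD** with the Boltzmann-suppressed action defect.  For `β > 0`, `δ > 0`, `η > 0` and every
physical zero-flux `ψ`: `⟨ψ,K_βψ⟩ ≤ ⟨ψ_in,Kψ_in⟩ + ⟨ψ_val,Kψ_val⟩ + onionErr₂ L β δ η · c_β^{|E|} · ‖ψ‖²`, `ψ_in = cos Θ_δ·ψ`, `ψ_val = cos Θ'_η·(sin Θ_δ·ψ)`.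
[cite: SimonB1983DiscreteSpectrum, §3] [cite: Luscher1983, §2] -/
theorem qform_le_three_regions_lat₂ {β : ℝ} (hβ : 0 < β) {δ : ℝ} (hδ : 0 < δ) {η : ℝ} (hη : 0 < η)
    {ψ : GaugeConfig 3 L SU2 → ℝ} (hψ : IsPhys ψ) :
    qform su2Rep β ψ ψ ≤
      qform su2Rep β (fun U => Real.cos (innerPhase δ U) * ψ U) (fun U => Real.cos (innerPhase δ U) * ψ U)
      + qform su2Rep β (fun U => Real.cos (actionPhase η U) * (Real.sin (innerPhase δ U) * ψ U))
          (fun U => Real.cos (actionPhase η U) * (Real.sin (innerPhase δ U) * ψ U))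
      + onionErr₂ L β δ η * latCE L β * l2 ψ ψ := by
  set φ : GaugeConfig 3 L SU2 → ℝ := fun U => Real.sin (innerPhase δ U) * ψ U with hφ
  have hφP : IsPhys φ := isPhys_outer δ hψ
  set χ : GaugeConfig 3 L SU2 → ℝ := fun U => Real.sin (actionPhase η U) * φ U with hχ
  have hχP : IsPhys χ := isPhys_largeField η hφP
  have hA := qform_le_inner_outer_lat hβ hδ hψ
  have hB := qform_le_localized_actionPhase₂ hβ hη hφP
  have hC : qform su2Rep β χ χ ≤ Real.exp (-(β * η)) * latCE L β * l2 χ χ :=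
    qform_le_exp_neg_of_action_ge_lat hβ.le hχP fun U hU => (action_gt_of_sin_actionPhase_ne_zero hη (left_ne_zero_of_mul hU)).le
  have hφl2 : l2 φ φ ≤ l2 ψ ψ := l2_mul_le hψ fun U => Real.abs_sin_le_one _
  have hχl2 : l2 χ χ ≤ l2 ψ ψ := (l2_mul_le hφP fun U => Real.abs_sin_le_one _).trans hφl2
  have hl2ψ : 0 ≤ l2 ψ ψ := by unfold l2; exact integral_nonneg fun U => mul_self_nonneg _
  have hCE : 0 ≤ latCE L β := (latCE_pos hβ.le).le
  have hC' : qform su2Rep β χ χ ≤ Real.exp (-(β * η)) * latCE L β * l2 ψ ψ :=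
    hC.trans (mul_le_mul_of_nonneg_left hχl2 (by positivity))
  have hBerr : (1 / 2) * ((π ^ 2 / 4) * Real.exp (-(β * η / 2)) * latCE L β) * l2 φ φ ≤
      (1 / 2) * ((π ^ 2 / 4) * Real.exp (-(β * η / 2)) * latCE L β) * l2 ψ ψ :=
    mul_le_mul_of_nonneg_left hφl2 (by positivity)
  have htot : qform su2Rep β ψ ψ ≤
      qform su2Rep β (fun U => Real.cos (innerPhase δ U) * ψ U) (fun U => Real.cos (innerPhase δ U) * ψ U)
      + (qform su2Rep β (fun U => Real.cos (actionPhase η U) * φ U) (fun U => Real.cos (actionPhase η U) * φ U)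
          + Real.exp (-(β * η)) * latCE L β * l2 ψ ψ
          + (1 / 2) * ((π ^ 2 / 4) * Real.exp (-(β * η / 2)) * latCE L β) * l2 ψ ψ)
      + (1 / 2) * ((Fintype.card (Edge 3 L) : ℝ) ^ 2 * (8 * π / δ) ^ 2 * (3 / β) * latCE L β) * l2 ψ ψ := by
    have hB' : qform su2Rep β φ φ ≤ qform su2Rep β (fun U => Real.cos (actionPhase η U) * φ U) (fun U => Real.cos (actionPhase η U) * φ U)
        + Real.exp (-(β * η)) * latCE L β * l2 ψ ψ
        + (1 / 2) * ((π ^ 2 / 4) * Real.exp (-(β * η / 2)) * latCE L β) * l2 ψ ψ := by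
      linarith [hB, hC', hBerr]
    linarith [hA, hB']
  refine htot.trans (le_of_eq ?_)
  unfold onionErr₂
  ring

/-! ## §3 Admissible scales for the refined onion: any action exponent `q ∈ (0, 1)` -/

variable (L) in
/-- **Admissible IMS scales for the refined onion**: `δ, η > 0` and `∀ κ > 0`, eventually `onionErr₂ L β (δ β) (η β) ≤ κ·λ_b(L³β)·uniformFloorConst L`.
A hypothesis shape of this programme. [folklore] -/
def ScalesAdmissible₂ (δ η : ℝ → ℝ) : Prop :=
  (∀ β : ℝ, 0 < δ β) ∧ (∀ β : ℝ, 0 < η β) ∧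
    ∀ κ : ℝ, 0 < κ → ∃ β0 : ℝ, ∀ β : ℝ, β0 ≤ β →
      onionErr₂ L β (δ β) (η β) ≤ κ * bareLambda ((L : ℝ) ^ 3 * β) * uniformFloorConst L

/-- The `δ`-term of `onionErr₂` is dominated by the old onion error at scales `(δ, δ)` (`β > 0`). [folklore] -/
theorem onionErr₂_delta_le_onionErr {β : ℝ} (hβ : 0 < β) (δ η' : ℝ) :
    (1 / 2) * ((Fintype.card (Edge 3 L) : ℝ) ^ 2 * (3 / β) * (8 * π / δ) ^ 2) ≤ onionErr L β δ η' := by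
  unfold onionErr
  have h1 : 0 ≤ Real.exp (-(β * η')) := (Real.exp_pos _).le
  have h2 : 0 ≤ (1 / 2) * ((Fintype.card (Edge 3 L) : ℝ) ^ 2 * (3 / β) * (4 * π * Fintype.card (Plaquette 3 L) / η') ^ 2) := by positivity
  nlinarith [h1, h2]

/-- The two Boltzmann terms of `onionErr₂` at `η = β^{−q}`: `e^{−βη} + (π²/8)e^{−βη/2} ≤ (1 + π²/4)·β^{−(2/3−q)}·β^{−1/3}` (`β ≥ 1`). [folklore] -/
theorem boltzmann_terms_le {β q : ℝ} (hβ : 1 ≤ β) :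
    Real.exp (-(β * powScale q β)) + π ^ 2 / 8 * Real.exp (-(β * powScale q β / 2)) ≤
      (1 + π ^ 2 / 4) * (β ^ (-(2 / 3 - q)) * β ^ (-(1 : ℝ) / 3)) := by
  have hβ0 : 0 < β := by linarith
  rw [powScale_eq hβ]
  have hx : β * β ^ (-q) = β ^ (1 - q) := by rw [sub_eq_add_neg, Real.rpow_add hβ0, Real.rpow_one]
  have hxpos : 0 < β ^ (1 - q) := Real.rpow_pos_of_pos hβ0 _
  have hxinv : 1 / β ^ (1 - q) = β ^ (-(2 / 3 - q)) * β ^ (-(1 : ℝ) / 3) := by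
    rw [one_div, ← Real.rpow_neg hβ0.le, ← Real.rpow_add hβ0]; congr 1; ring
  rw [hx]
  have hexp : ∀ x : ℝ, 0 < x → Real.exp (-x) ≤ 1 / x := fun x hx0 => by
    rw [Real.exp_neg, one_div]
    exact inv_anti₀ hx0 (by linarith [Real.add_one_le_exp x])
  have h1 : Real.exp (-(β ^ (1 - q))) ≤ 1 / β ^ (1 - q) := hexp _ hxpos
  have h2 : Real.exp (-(β ^ (1 - q) / 2)) ≤ 2 * (1 / β ^ (1 - q)) := by
    have h := hexp _ (half_pos hxpos)
    refine h.trans (le_of_eq ?_)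
    field_simp
  rw [← hxinv]
  have h0 : 0 ≤ 1 / β ^ (1 - q) := by positivity
  nlinarith [h1, h2, h0, Real.pi_pos]

/-- ★ **Polynomial scales are admissible for the refined onion**: `δ = β^{−p}`, `η = β^{−q}` with `0 < p < 1/3` and `0 < q < 2/3` (in particular the
VALLEY-friendly `q ∈ (1/2, 2/3)`; larger `q < 1` also work with sharper Boltzmann bounds, not typed). [cite: SimonB1983DiscreteSpectrum, §3] -/
theorem scalesAdmissible₂_powScale {p q : ℝ} (hp0 : 0 < p) (hp : p < 1 / 3) (hq : q < 2 / 3) :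
    ScalesAdmissible₂ L (powScale p) (powScale q) := by
  refine ⟨fun β => powScale_pos p β, fun β => powScale_pos q β, fun κ hκ => ?_⟩
  have hL : (0 : ℝ) < (L : ℝ) ^ 3 := by
    have : (0 : ℝ) < L := by exact_mod_cast Nat.pos_of_ne_zero (NeZero.ne L)
    positivity
  have hcL := uniformFloorConst_pos (L := L)
  -- the δ-term through the old admissibility at scales `(p, p)` with `κ/2`
  obtain ⟨-, -, hold⟩ := scalesAdmissible_powScale (L := L) hp0 hp
  obtain ⟨β1, hβ1⟩ := hold (κ / 2) (half_pos hκ)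
  -- the Boltzmann terms
  set κ' : ℝ := κ / 2 * (2 / (L : ℝ) ^ 3) ^ ((1 : ℝ) / 3) * uniformFloorConst L with hκ'
  have hκ'0 : 0 < κ' := by rw [hκ']; positivity
  have hq1 : 0 < 2 / 3 - q := by linarith
  obtain ⟨β2, hβ2⟩ := rpow_neg_eventually_le hq1 (M := κ' / (1 + π ^ 2 / 4)) (by positivity)
  refine ⟨max β1 β2, fun β hβ => ?_⟩
  have hb1 : β1 ≤ β := (le_max_left _ _).trans hβ
  obtain ⟨hβone, hB⟩ := hβ2 β ((le_max_right _ _).trans hβ)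
  have hβ0 : 0 < β := by linarith
  have hδ := (onionErr₂_delta_le_onionErr (L := L) hβ0 (powScale p β) (powScale p β)).trans (hβ1 β hb1)
  have hBz := boltzmann_terms_le (q := q) hβone
  have hb3 : 0 < β ^ (-(1 : ℝ) / 3) := Real.rpow_pos_of_pos hβ0 _
  have hBz' : Real.exp (-(β * powScale q β)) + π ^ 2 / 8 * Real.exp (-(β * powScale q β / 2)) ≤
      κ / 2 * bareLambda ((L : ℝ) ^ 3 * β) * uniformFloorConst L := by
    rw [bareLambda_cube_eq (L := L) hβ0]
    refine hBz.trans ?_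
    have h1 : (1 + π ^ 2 / 4) * (β ^ (-(2 / 3 - q)) * β ^ (-(1 : ℝ) / 3)) ≤ (1 + π ^ 2 / 4) * (κ' / (1 + π ^ 2 / 4) * β ^ (-(1 : ℝ) / 3)) :=
      mul_le_mul_of_nonneg_left (mul_le_mul_of_nonneg_right hB hb3.le) (by positivity)
    refine h1.trans (le_of_eq ?_)
    rw [hκ']; field_simp
  unfold onionErr₂
  linarith [hδ, hBz']

end Summit.QuantumFields.YangMills.Theorems.FemtoTransferGap

end
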